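import Literature.AnabelianGeometry.EtaleTheta.Discharge.Sec5TowerOfConnectedTemperoid
import Literature.AnabelianGeometry.EtaleTheta.Discharge.Sec5RootTransitionsModel
import Literature.AnabelianGeometry.EtaleTheta.Discharge.Sec5RootOfRootModelSections

/-!
# [EtTh] Prop. 5.2 (i) for GIVEN sections and the Rmk. 4.3.2 transitions over the GENUINE connected base `B^temp(Π^tp_X)⁰` —
# the naturality law `hS` and `Φ` divisorial DISCHARGED; the transition INPUTS of `ofConnectedTemperoidFamily` PRODUCED
# (Prop. 4.2 (iii) p. 314, Rmk. 4.3.2 pp. 318–319, Prop. 5.2 (i) p. 324, §5 pp. 330–331 / PDF pp. 88, 92–93, 98, 104–105)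

Mochizuki, *The étale theta function and its Frobenioid-theoretic manifestations*, Publ. RIMS **45** (2009): Prop. 5.2 (i)
p. 324 (PDF p. 98) «The pair of morphisms of `C` determined by "`s_{l·N}`", "`τ_{l·N}`" constitutes an `l·N`-th root of a right
fraction-pair … of … `Θ̈` …, or, alternatively, an `N`-th root of a right fraction-pair … of … an `l`-th root of … `Θ̈`
[cf. Remark 4.3.2]»; Rmk. 4.3.2 pp. 318–319 (PDF pp. 92–93) «if `N` divides `N′` … there exists a "morphism" from a suitable
`N′`-th root … to the given `N`-th root …, i.e., a pair of commutative diagrams … where `α_{N,N′}` (respectively, `β_{N,N′}`) is an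
isometry of Frobenius degree `N′/N` …; `α_{N,N′}` is of base-Frobenius type … by allowing `N` to vary, we obtain a compatible
system of roots»; Def. 4.1 (ii) p. 313 (PDF p. 87) («natural surjective outer homomorphism `Π^tp_X ↠ Aut_D(A)`»)
[cite: MochizukiEtTh2009, Prop 5.2 (i) p.324 (PDF p.98); Rmk 4.3.2 p.318–319 (PDF pp.92–93); Def 4.1 (ii) p.313 (PDF p.87)].

abc-iut cell, layer L2, PROOF-ONLY consumer companion (0 `def`s; seat abc-iut-w6-d053 gen 4, row «RMK432-TRANSITIONS +
GIVEN-SECTIONS ROOTS AT mkOfConnectedTemperoid», GO abc-iut-w5-d134 g4 STATUS 10:13:17Z) of abc-iut-w5-d134's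
`Discharge/Sec5RootOfRootModelSections.lean` (p434932 / p435479) and `Discharge/Sec5RootTransitionsModel.lean` (p437189), read at
abc-iut-L2-t4's §4 setting over the GENUINE connected base `D := B^temp(Π^tp_X)⁰`
(`BiKummerSetting.mkOfConnectedTemperoid`, `Discharge/Sec5OfConnectedTemperoid.lean`) and at their §5 tower
`ThetaFrobenioidTower.ofConnectedTemperoidFamily` (`Discharge/Sec5TowerOfConnectedTemperoid.lean`).  Nothing landed is edited or
restated; every input with a name is consumed BY NAME:
* the Def. 4.1 (ii) naturality law `hS` of p434932's theorems is the THEOREM `BiKummerSetting.mkOfConnectedTemperoid_galoisSurj_natural`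
  over `B^temp(Π^tp_X)⁰` — so `exists_rootSquares_of_cover_mkOfConnectedTemperoid`, `pairIsNthRootOf_of_cover_mkOfConnectedTemperoid`,
  `pairIsNthRootOf_mul_of_cover_mkOfConnectedTemperoid`, `pairIsNthRootOf_mul_of_rootOnAodot_mkOfConnectedTemperoid` hold modulo
  `Φ` divisorial (`hΦd`) ALONE (and at the §5 data, where the [FrdI] Thm. 5.2 hypotheses `h` are carried, `hΦd := h.isDivisorial`);
* `exists_rootTransition_of_nthRoots_of_dvd_mkOfConnectedTemperoid` — p437189's Rmk. 4.3.2 transition in the DIVISIBILITY index shape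
  `(N : ℕ) ∣ N′` of the tower fields (root compatibility as `f_{N′}^{N′/N} = φ^* f_N`);
* `ThetaFrobenioidTower.exists_transitions_ofConnectedTemperoid` — **the nine Rmk. 4.3.2 transition INPUTS of
  `ofConnectedTemperoidFamily`** (`α`, `β`, `comm_sCap`, `comm_sCup`, `isIsometry_α`, `degFr_α`, `isIsometry_β`, `degFr_β`,
  `baseFrob_α`, in exactly its binder types — «inputs left» of `Discharge/Sec5TowerOfConnectedTemperoid.lean`) are PRODUCED, as one
  `∃`-statement, from a family of root data `R N` and a family of pull-back coverings `φ_{N,N′} : A_{N′} → A_N` (`N ∣ N′`) over which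
  the pull-back parts compose, the roots are compatible and the skeleton clause holds — print's «compatible system» situation
  `Z̈_{l·N′} → Z̈_{l·N}`; `Φ` divisorial := `h.isDivisorial`.  `exists_transitions_with_given_ofConnectedTemperoid` records in addition
  `Base(α_{N,N′}) = Base(φ_{N,N′})`;
* `ThetaFrobenioidTower.exists_tower_atLevel_eq_ofConnectedTemperoidData` — hence, for a §2 tower `𝒯`, constants and the divisor
  invariances, a `ThetaFrobenioidTower` over `mkOfConnectedTemperoid` whose levels `M ∈ E` ARE the §5 data
  `ThetaFrobenioid.ofConnectedTemperoidData` over `𝒯.level M`, with `StrvSection` at every level — the tower assembled with NO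
  transition input (abc-iut-L2-t4's `ofConnectedTemperoidFamily`, `atLevel_ofConnectedTemperoidFamily_eq`,
  `strvSection_atLevel_ofConnectedTemperoidFamily` by name).
One corollary per theorem serves the §5 choice `A_⊙^bs := Ÿ` (`mkOfConnectedTemperoidYdd`, `mkOfConnectedTemperoidYddTower`) and the
Setting forms by unfolding (`A₀`, `hA₀`, `hA₀'` arbitrary here).

HONEST FRAMING: kernel-checked implications for data so typed; the coherent CHOICE of covers/roots along a cofinal chain of levels
(the remaining abstract content of «compatible system») is NOT supplied here — the covering family is an input; nothing asserts that
such data exist for an actual curve; the parameter class `TemperedFrobenioid T₀ (ConnectedPart (BTemp X.Pi)) VD` is not shown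
inhabited here; typed ≠ proved except for the theorems of this file; no side is taken on [IUTchIII] Cor. 3.12.
-/

noncomputable section

namespace Literature.AnabelianGeometry.EtaleTheta

open CategoryTheory Opposite Literature.AlgebraicGeometry.Frobenioids Literature.AnabelianGeometry.SemiGraphs
  Literature.AnabelianGeometry.SemiGraphs.GaloisObjects

universe u₀ v₀ w

/-! ## Part A — at the §4 setting `mkOfConnectedTemperoid` over `B^temp(Π^tp_X)⁰`: `hS` discharged -/
namespace BiKummerSetting

section ConnectedTemperoid

variable {K : Type u₀} [Field K] (X : SemiGraphs.TemperedArithmeticGroup.{u₀} K) {D₀ : Type u₀} [Category.{v₀} D₀]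
  {V : FrdIMonoidStub.{w}} {T₀ : RealifiedDivisorMonoids (D₀ := D₀) V}
  {VD : FrdICatStub.{u₀ + 1, u₀, w} (ConnectedPart (BTemp X.Pi))}
  (tf : TemperedFrobenioid T₀ (ConnectedPart (BTemp X.Pi)) VD) (hZ : tf.monoidType = MonoidType.Z)
  (hP : ∀ A : (ConnectedPart (BTemp X.Pi))ᵒᵖ, IsPerfect (tf.Φ.carrier A))
  (NH : Subgroup (Field.absoluteGaloisGroup K) → tf.category → ℕ+ → Prop)
  (A₀ : tf.category) (hA₀ : PreFrobenioid.IsFrobeniusTrivial tf.toElem A₀) (hA₀' : SemiGraphs.IsGaloisObj A₀.base.obj)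
  (hΦd : Objectwise (fun M _ => IsDivisorial M) tf.divisorMonoid)

include hΦd in
/-- **The two root squares over a GIVEN covering and GIVEN sections, over `B^temp(Π^tp_X)⁰`** ([EtTh] Prop. 4.2 (iii) data with
the `N`-domain prescribed): abc-iut-w5-d134's `exists_rootSquares_of_cover_mkOfModelCanonical` with the Def. 4.1 (ii) naturality
law `hS` DISCHARGED by `mkOfConnectedTemperoid_galoisSurj_natural`; modulo `Φ` divisorial only.
[cite: MochizukiEtTh2009, Prop 4.2 (iii) p.314 (PDF p.88); Def 4.1 (ii) p.313 (PDF p.87)] -/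
theorem exists_rootSquares_of_cover_mkOfConnectedTemperoid
    {A B : tf.category} (hAft : PreFrobenioid.IsFrobeniusTrivial tf.toElem A) (hAG : SemiGraphs.IsGaloisObj A.base.obj)
    {f : tf.biratUnitsModel A} (hfix : (mkOfConnectedTemperoid X tf hZ hP NH A₀ hA₀ hA₀').IsFixedByHA A hAG f)
    (P : (mkOfConnectedTemperoid X tf hZ hP NH A₀ hA₀ hA₀').FractionPair f B) (N : ℕ+)
    {AN BN : tf.category} (φ : AN ⟶ A) (hφ : PreFrobenioid.IsPullbackMorphism tf.toElem φ)
    (hft : PreFrobenioid.IsFrobeniusTrivial tf.toElem AN) (hG : SemiGraphs.IsGaloisObj AN.base.obj)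
    (hsk₁ : Nonempty (AN.base ≅ A.base) → AN = A) (hμN : tf.IsMuSaturated AN N)
    (hcN : ∃ (A₁ A₂ : tf.category) (s₁ : A₁ ⟶ AN) (s₂ : A₁ ⟶ A₂),
      (mkOfConnectedTemperoid X tf hZ hP NH A₀ hA₀ hA₀').IsPreStep s₁ ∧
        (mkOfConnectedTemperoid X tf hZ hP NH A₀ hA₀ hA₀').IsPreStep s₂ ∧
          (mkOfConnectedTemperoid X tf hZ hP NH A₀ hA₀ hA₀').IsFrobeniusTrivial A₂ ∧
            (mkOfConnectedTemperoid X tf hZ hP NH A₀ hA₀ hA₀').IsNHSaturatedBsFld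
              (mkOfConnectedTemperoid X tf hZ hP NH A₀ hA₀ hA₀').HodotBsFld A₂ N)
    {gN : tf.biratUnitsModel AN} (hgN : gN ^ (N : ℕ) = tf.pullFracModel φ f)
    (Q : (mkOfConnectedTemperoid X tf hZ hP NH A₀ hA₀ hA₀').FractionPair gN BN)
    (hQn : ModelFrobenioid.div Q.num ^ (N : ℕ) =
      pull tf.divisorMonoid (ModelFrobenioid.baseMap φ) (ModelFrobenioid.div P.num))
    (hQd : ModelFrobenioid.div Q.den ^ (N : ℕ) =
      pull tf.divisorMonoid (ModelFrobenioid.baseMap φ) (ModelFrobenioid.div P.den)) :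
    ∃ (α : AN ⟶ A) (β : BN ⟶ B) (d : (mkOfConnectedTemperoid X tf hZ hP NH A₀ hA₀ hA₀').BaseFrobeniusTypeData α),
      (mkOfConnectedTemperoid X tf hZ hP NH A₀ hA₀ hA₀').IsIsometry α ∧
        (mkOfConnectedTemperoid X tf hZ hP NH A₀ hA₀ hA₀').IsIsometry β ∧
          (mkOfConnectedTemperoid X tf hZ hP NH A₀ hA₀ hA₀').degFr α = N ∧
            (mkOfConnectedTemperoid X tf hZ hP NH A₀ hA₀ hA₀').degFr β = N ∧
              Q.num ≫ β = α ≫ P.num ∧ Q.den ≫ β = α ≫ P.den ∧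
                ModelFrobenioid.baseMap d.α₁ = ModelFrobenioid.baseMap φ ∧
                  gN ^ (N : ℕ) = tf.pullFracModel d.α₁ f ∧
                    (mkOfConnectedTemperoid X tf hZ hP NH A₀ hA₀ hA₀').IsSaturated AN N (tf.pullFracModel d.α₁ f) :=
  exists_rootSquares_of_cover_mkOfModelCanonical X tf hZ hP _ _ _ NH A₀ hA₀ hA₀' hΦd
    (mkOfConnectedTemperoid_galoisSurj_natural X tf hZ hP NH A₀ hA₀ hA₀') hAft hAG hfix P N φ hφ hft hG hsk₁ hμN hcN hgN Q
    hQn hQd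

include hΦd in
/-- **[EtTh] Prop. 5.2 (i) shape for GIVEN sections over `B^temp(Π^tp_X)⁰` — «the pair `(s, τ)` constitutes an `N`-th root of the
right fraction-pair `P`»** (`PairIsNthRootOf`, Prop. 4.2 (iii)): abc-iut-w5-d134's `pairIsNthRootOf_of_cover_mkOfModelCanonical`
with `hS` discharged.  [cite: MochizukiEtTh2009, Prop 5.2 (i) p.324 (PDF p.98); Def 4.1 (ii) p.313 (PDF p.87)] -/
theorem pairIsNthRootOf_of_cover_mkOfConnectedTemperoid
    {A B : tf.category} (hAft : PreFrobenioid.IsFrobeniusTrivial tf.toElem A) (hAG : SemiGraphs.IsGaloisObj A.base.obj)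
    {f : tf.biratUnitsModel A} (hfix : (mkOfConnectedTemperoid X tf hZ hP NH A₀ hA₀ hA₀').IsFixedByHA A hAG f)
    (P : (mkOfConnectedTemperoid X tf hZ hP NH A₀ hA₀ hA₀').FractionPair f B) (N : ℕ+)
    {AN BN : tf.category} (φ : AN ⟶ A) (hφ : PreFrobenioid.IsPullbackMorphism tf.toElem φ)
    (hft : PreFrobenioid.IsFrobeniusTrivial tf.toElem AN) (hG : SemiGraphs.IsGaloisObj AN.base.obj)
    (hsk₁ : Nonempty (AN.base ≅ A.base) → AN = A) (hμN : tf.IsMuSaturated AN N)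
    (hcN : ∃ (A₁ A₂ : tf.category) (s₁ : A₁ ⟶ AN) (s₂ : A₁ ⟶ A₂),
      (mkOfConnectedTemperoid X tf hZ hP NH A₀ hA₀ hA₀').IsPreStep s₁ ∧
        (mkOfConnectedTemperoid X tf hZ hP NH A₀ hA₀ hA₀').IsPreStep s₂ ∧
          (mkOfConnectedTemperoid X tf hZ hP NH A₀ hA₀ hA₀').IsFrobeniusTrivial A₂ ∧
            (mkOfConnectedTemperoid X tf hZ hP NH A₀ hA₀ hA₀').IsNHSaturatedBsFld
              (mkOfConnectedTemperoid X tf hZ hP NH A₀ hA₀ hA₀').HodotBsFld A₂ N)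
    {gN : tf.biratUnitsModel AN} (hgN : gN ^ (N : ℕ) = tf.pullFracModel φ f)
    (Q : (mkOfConnectedTemperoid X tf hZ hP NH A₀ hA₀ hA₀').FractionPair gN BN)
    (hQn : ModelFrobenioid.div Q.num ^ (N : ℕ) =
      pull tf.divisorMonoid (ModelFrobenioid.baseMap φ) (ModelFrobenioid.div P.num))
    (hQd : ModelFrobenioid.div Q.den ^ (N : ℕ) =
      pull tf.divisorMonoid (ModelFrobenioid.baseMap φ) (ModelFrobenioid.div P.den)) :
    (mkOfConnectedTemperoid X tf hZ hP NH A₀ hA₀ hA₀').PairIsNthRootOf (fun {_ _} φ x => tf.pullFracModel φ x)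
      (N : ℕ) f Q.num Q.den :=
  pairIsNthRootOf_of_cover_mkOfModelCanonical X tf hZ hP _ _ _ NH A₀ hA₀ hA₀' hΦd
    (mkOfConnectedTemperoid_galoisSurj_natural X tf hZ hP NH A₀ hA₀ hA₀') hAft hAG hfix P N φ hφ hft hG hsk₁ hμN hcN hgN Q
    hQn hQd

include hΦd in
/-- **[EtTh] Prop. 5.2 (i), BOTH printed alternatives, for GIVEN sections over a GIVEN covering of the `l`-domain, over
`B^temp(Π^tp_X)⁰`**: abc-iut-w5-d134's `pairIsNthRootOf_mul_of_cover_mkOfModelCanonical` with `hS` discharged — `(s, τ)` is an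
`l·N`-th root of `θ`'s pair AND an `N`-th root of the `l`-th root's pair, modulo `Φ` divisorial, the `H_{A_l}`-fixedness `hfixl` of
`f_l` and print's «definition of `J̈_{l·N}`» clauses on `A_N` (`hsk₀`, `hsk₁`, `hμ`, `hcondA`, `hcN`).
[cite: MochizukiEtTh2009, Prop 5.2 (i) p.324 (PDF p.98); Rmk 4.3.2 p.318 (PDF p.92)] -/
theorem pairIsNthRootOf_mul_of_cover_mkOfConnectedTemperoid
    {Bl : tf.category} {θ : tf.biratUnitsModel A₀}
    {Pl : (mkOfConnectedTemperoid X tf hZ hP NH A₀ hA₀ hA₀').FractionPair θ Bl} {lv : ℕ+}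
    (Rl : (mkOfConnectedTemperoid X tf hZ hP NH A₀ hA₀ hA₀').NthRoot θ Pl lv (fun {_} φ x => tf.pullFracModel φ x))
    (hfixl : (mkOfConnectedTemperoid X tf hZ hP NH A₀ hA₀ hA₀').IsFixedByHA Rl.AN Rl.αData.isGalois Rl.root)
    (N : ℕ+) {AN BN : tf.category} (φ : AN ⟶ Rl.AN) (hφ : PreFrobenioid.IsPullbackMorphism tf.toElem φ)
    (hft : PreFrobenioid.IsFrobeniusTrivial tf.toElem AN) (hG : SemiGraphs.IsGaloisObj AN.base.obj)
    (hsk₀ : Nonempty (AN.base ≅ A₀.base) → AN = A₀) (hsk₁ : Nonempty (AN.base ≅ Rl.AN.base) → AN = Rl.AN)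
    (hμ : tf.IsMuSaturated AN (lv * N))
    (hcondA : ∃ (A₁ A₂ : tf.category) (s₁ : A₁ ⟶ AN) (s₂ : A₁ ⟶ A₂),
      (mkOfConnectedTemperoid X tf hZ hP NH A₀ hA₀ hA₀').IsPreStep s₁ ∧
        (mkOfConnectedTemperoid X tf hZ hP NH A₀ hA₀ hA₀').IsPreStep s₂ ∧
          (mkOfConnectedTemperoid X tf hZ hP NH A₀ hA₀ hA₀').IsFrobeniusTrivial A₂ ∧
            (mkOfConnectedTemperoid X tf hZ hP NH A₀ hA₀ hA₀').IsNHSaturatedBsFld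
              (mkOfConnectedTemperoid X tf hZ hP NH A₀ hA₀ hA₀').HodotBsFld A₂ (lv * N))
    (hcN : ∃ (A₁ A₂ : tf.category) (s₁ : A₁ ⟶ AN) (s₂ : A₁ ⟶ A₂),
      (mkOfConnectedTemperoid X tf hZ hP NH A₀ hA₀ hA₀').IsPreStep s₁ ∧
        (mkOfConnectedTemperoid X tf hZ hP NH A₀ hA₀ hA₀').IsPreStep s₂ ∧
          (mkOfConnectedTemperoid X tf hZ hP NH A₀ hA₀ hA₀').IsFrobeniusTrivial A₂ ∧
            (mkOfConnectedTemperoid X tf hZ hP NH A₀ hA₀ hA₀').IsNHSaturatedBsFld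
              (mkOfConnectedTemperoid X tf hZ hP NH A₀ hA₀ hA₀').HodotBsFld A₂ N)
    {gN : tf.biratUnitsModel AN} (hgN : gN ^ (N : ℕ) = tf.pullFracModel φ Rl.root)
    (Q : (mkOfConnectedTemperoid X tf hZ hP NH A₀ hA₀ hA₀').FractionPair gN BN)
    (hQn : ModelFrobenioid.div Q.num ^ (N : ℕ) =
      pull tf.divisorMonoid (ModelFrobenioid.baseMap φ) (ModelFrobenioid.div Rl.pair.num))
    (hQd : ModelFrobenioid.div Q.den ^ (N : ℕ) =
      pull tf.divisorMonoid (ModelFrobenioid.baseMap φ) (ModelFrobenioid.div Rl.pair.den)) :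
    (mkOfConnectedTemperoid X tf hZ hP NH A₀ hA₀ hA₀').PairIsNthRootOf (fun {_ _} φ x => tf.pullFracModel φ x)
        ((lv : ℕ) * N) θ Q.num Q.den ∧
      (mkOfConnectedTemperoid X tf hZ hP NH A₀ hA₀ hA₀').PairIsNthRootOf (fun {_ _} φ x => tf.pullFracModel φ x)
        (N : ℕ) Rl.root Q.num Q.den :=
  pairIsNthRootOf_mul_of_cover_mkOfModelCanonical X tf hZ hP _ _ _ NH A₀ hA₀ hA₀' hΦd
    (mkOfConnectedTemperoid_galoisSurj_natural X tf hZ hP NH A₀ hA₀ hA₀') Rl hfixl N φ hφ hft hG hsk₀ hsk₁ hμ hcondA hcN hgN Q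
    hQn hQd

include hΦd in
/-- **[EtTh] Prop. 5.2 (i), BOTH printed alternatives, in the DOUBLE-UNDERLINE reading (the `l`-th root carried by `A_⊙` itself),
over `B^temp(Π^tp_X)⁰`, from §1-type inputs only**: abc-iut-w5-d134's `pairIsNthRootOf_mul_of_rootOnAodot_mkOfModelCanonical` (v2 of
p435479) with `hS` discharged — modulo `Φ` divisorial and the printed clauses (`μ_l`-saturation of `A_⊙` and Def. 4.1 (iii)(a) at
`l`; the covering `A_N → A_⊙` Frobenius-trivial, Galois, in a skeleton through `A_⊙`, `μ_{l·N}`-saturated, Def. 4.1 (iii)(a) at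
`l·N` and at `N`; the root `g_N` of `f_l|_{A_N}` and the divisor bookkeeping of `(s, τ)`).
[cite: MochizukiEtTh2009, Prop 5.2 (i) p.324 (PDF p.98); Def 4.1 (ii) p.313 (PDF p.87)] -/
theorem pairIsNthRootOf_mul_of_rootOnAodot_mkOfConnectedTemperoid
    {B Bl : tf.category} {θ : tf.biratUnitsModel A₀}
    (P : (mkOfConnectedTemperoid X tf hZ hP NH A₀ hA₀ hA₀').FractionPair θ B) (lv : ℕ+)
    {fl : tf.biratUnitsModel A₀} (hfl : fl ^ (lv : ℕ) = θ)
    (Pl : (mkOfConnectedTemperoid X tf hZ hP NH A₀ hA₀ hA₀').FractionPair fl Bl)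
    (hPln : ModelFrobenioid.div Pl.num ^ (lv : ℕ) = ModelFrobenioid.div P.num)
    (hPld : ModelFrobenioid.div Pl.den ^ (lv : ℕ) = ModelFrobenioid.div P.den)
    (hμl : tf.IsMuSaturated A₀ lv)
    (hcl : ∃ (A₁ A₂ : tf.category) (s₁ : A₁ ⟶ A₀) (s₂ : A₁ ⟶ A₂),
      (mkOfConnectedTemperoid X tf hZ hP NH A₀ hA₀ hA₀').IsPreStep s₁ ∧
        (mkOfConnectedTemperoid X tf hZ hP NH A₀ hA₀ hA₀').IsPreStep s₂ ∧
          (mkOfConnectedTemperoid X tf hZ hP NH A₀ hA₀ hA₀').IsFrobeniusTrivial A₂ ∧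
            (mkOfConnectedTemperoid X tf hZ hP NH A₀ hA₀ hA₀').IsNHSaturatedBsFld
              (mkOfConnectedTemperoid X tf hZ hP NH A₀ hA₀ hA₀').HodotBsFld A₂ lv)
    (N : ℕ+) {AN BN : tf.category} (φ : AN ⟶ A₀) (hφ : PreFrobenioid.IsPullbackMorphism tf.toElem φ)
    (hft : PreFrobenioid.IsFrobeniusTrivial tf.toElem AN) (hG : SemiGraphs.IsGaloisObj AN.base.obj)
    (hsk₀ : Nonempty (AN.base ≅ A₀.base) → AN = A₀) (hμ : tf.IsMuSaturated AN (lv * N))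
    (hcondA : ∃ (A₁ A₂ : tf.category) (s₁ : A₁ ⟶ AN) (s₂ : A₁ ⟶ A₂),
      (mkOfConnectedTemperoid X tf hZ hP NH A₀ hA₀ hA₀').IsPreStep s₁ ∧
        (mkOfConnectedTemperoid X tf hZ hP NH A₀ hA₀ hA₀').IsPreStep s₂ ∧
          (mkOfConnectedTemperoid X tf hZ hP NH A₀ hA₀ hA₀').IsFrobeniusTrivial A₂ ∧
            (mkOfConnectedTemperoid X tf hZ hP NH A₀ hA₀ hA₀').IsNHSaturatedBsFld
              (mkOfConnectedTemperoid X tf hZ hP NH A₀ hA₀ hA₀').HodotBsFld A₂ (lv * N))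
    (hcN : ∃ (A₁ A₂ : tf.category) (s₁ : A₁ ⟶ AN) (s₂ : A₁ ⟶ A₂),
      (mkOfConnectedTemperoid X tf hZ hP NH A₀ hA₀ hA₀').IsPreStep s₁ ∧
        (mkOfConnectedTemperoid X tf hZ hP NH A₀ hA₀ hA₀').IsPreStep s₂ ∧
          (mkOfConnectedTemperoid X tf hZ hP NH A₀ hA₀ hA₀').IsFrobeniusTrivial A₂ ∧
            (mkOfConnectedTemperoid X tf hZ hP NH A₀ hA₀ hA₀').IsNHSaturatedBsFld
              (mkOfConnectedTemperoid X tf hZ hP NH A₀ hA₀ hA₀').HodotBsFld A₂ N)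
    {gN : tf.biratUnitsModel AN} (hgN : gN ^ (N : ℕ) = tf.pullFracModel φ fl)
    (Q : (mkOfConnectedTemperoid X tf hZ hP NH A₀ hA₀ hA₀').FractionPair gN BN)
    (hQn : ModelFrobenioid.div Q.num ^ (N : ℕ) =
      pull tf.divisorMonoid (ModelFrobenioid.baseMap φ) (ModelFrobenioid.div Pl.num))
    (hQd : ModelFrobenioid.div Q.den ^ (N : ℕ) =
      pull tf.divisorMonoid (ModelFrobenioid.baseMap φ) (ModelFrobenioid.div Pl.den)) :
    (mkOfConnectedTemperoid X tf hZ hP NH A₀ hA₀ hA₀').PairIsNthRootOf (fun {_ _} φ x => tf.pullFracModel φ x)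
        ((lv : ℕ) * N) θ Q.num Q.den ∧
      (mkOfConnectedTemperoid X tf hZ hP NH A₀ hA₀ hA₀').PairIsNthRootOf (fun {_ _} φ x => tf.pullFracModel φ x)
        (N : ℕ) fl Q.num Q.den :=
  pairIsNthRootOf_mul_of_rootOnAodot_mkOfModelCanonical X tf hZ hP _ _ _ NH A₀ hA₀ hA₀' hΦd
    (mkOfConnectedTemperoid_galoisSurj_natural X tf hZ hP NH A₀ hA₀ hA₀') P lv hfl Pl hPln hPld hμl hcl N φ hφ hft hG hsk₀ hμ
    hcondA hcN hgN Q hQn hQd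

include hΦd in
/-- **The Rmk. 4.3.2 transition over `B^temp(Π^tp_X)⁰` in the DIVISIBILITY index shape of the tower fields**: for an `N`-th root
datum `R` and an `N′`-th root datum `R′` of the same fraction-pair with `N ∣ N′`, a pull-back morphism `φ : A_{N′} → A_N` over which
the pull-back parts compose (`Base(α′_{N′}) = Base φ ≫ Base(α′_N)`), compatible roots `f_{N′}^{N′/N} = φ^* f_N` and the skeleton
clause — `α : A_{N′} → A_N` of base-Frobenius type over `Base φ` and `β : B_{N′} → B_N`, isometries with `deg_Fr · N = N′`, completing
the two squares (abc-iut-w5-d134's `exists_rootTransition_of_nthRoots_of_mul_eq_mkOfModelCanonical`, p437189, with `M := N′/N`).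
[cite: MochizukiEtTh2009, Rmk 4.3.2 p.318–319 (PDF pp.92–93)] -/
theorem exists_rootTransition_of_nthRoots_of_dvd_mkOfConnectedTemperoid
    {A B : tf.category} {f : tf.biratUnitsModel A}
    {P : (mkOfConnectedTemperoid X tf hZ hP NH A₀ hA₀ hA₀').FractionPair f B} {N N' : ℕ+}
    (R : (mkOfConnectedTemperoid X tf hZ hP NH A₀ hA₀ hA₀').NthRoot f P N (fun {_} φ x => tf.pullFracModel φ x))
    (R' : (mkOfConnectedTemperoid X tf hZ hP NH A₀ hA₀ hA₀').NthRoot f P N' (fun {_} φ x => tf.pullFracModel φ x))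
    (hd : (N : ℕ) ∣ N') (φ : R'.AN ⟶ R.AN) (hφ : PreFrobenioid.IsPullbackMorphism tf.toElem φ)
    (hb : ModelFrobenioid.baseMap R'.αData.α₁ = ModelFrobenioid.baseMap φ ≫ ModelFrobenioid.baseMap R.αData.α₁)
    (hg : R'.root ^ ((N' : ℕ) / N) = tf.pullFracModel φ R.root)
    (hsk : Nonempty (R'.AN.base ≅ R.AN.base) → R'.AN = R.AN) :
    ∃ (α : R'.AN ⟶ R.AN) (β : R'.BN ⟶ R.BN),
      R'.pair.num ≫ β = α ≫ R.pair.num ∧ R'.pair.den ≫ β = α ≫ R.pair.den ∧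
        (mkOfConnectedTemperoid X tf hZ hP NH A₀ hA₀ hA₀').IsIsometry α ∧
          ((mkOfConnectedTemperoid X tf hZ hP NH A₀ hA₀ hA₀').degFr α : ℕ) * N = N' ∧
            (mkOfConnectedTemperoid X tf hZ hP NH A₀ hA₀ hA₀').IsIsometry β ∧
              ((mkOfConnectedTemperoid X tf hZ hP NH A₀ hA₀ hA₀').degFr β : ℕ) * N = N' ∧
                (mkOfConnectedTemperoid X tf hZ hP NH A₀ hA₀ hA₀').IsOfBaseFrobeniusType α ∧
                  ModelFrobenioid.baseMap α = ModelFrobenioid.baseMap φ := by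
  have hpos : 0 < (N' : ℕ) / N := Nat.div_pos (Nat.le_of_dvd N'.pos hd) N.pos
  let M : ℕ+ := ⟨(N' : ℕ) / N, hpos⟩
  have hM : M * N = N' := by
    apply PNat.eq
    rw [PNat.mul_coe]
    change (N' : ℕ) / N * N = N'
    exact Nat.div_mul_cancel hd
  have hg' : R'.root ^ (M : ℕ) = tf.pullFracModel φ R.root := hg
  exact exists_rootTransition_of_nthRoots_of_mul_eq_mkOfModelCanonical X tf hZ hP _ _ _ NH A₀ hA₀ hA₀' hΦd R R' M hM φ hφ
    hb hg' hsk

end ConnectedTemperoid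
end BiKummerSetting

/-! ## Part B — the Rmk. 4.3.2 transition INPUTS of the §5 tower `ofConnectedTemperoidFamily` PRODUCED from a covering family -/
namespace ThetaFrobenioidTower

variable {K : Type u₀} [Field K] {X : SemiGraphs.TemperedArithmeticGroup.{u₀} K} {D₀ : Type u₀} [Category.{v₀} D₀]
  {V : FrdIMonoidStub.{w}} {T₀ : RealifiedDivisorMonoids (D₀ := D₀) V}
  {VD : FrdICatStub.{u₀ + 1, u₀, w} (ConnectedPart (BTemp X.Pi))}
  {tf : TemperedFrobenioid T₀ (ConnectedPart (BTemp X.Pi)) VD} {hZ : tf.monoidType = MonoidType.Z}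
  {hP : ∀ A : (ConnectedPart (BTemp X.Pi))ᵒᵖ, IsPerfect (tf.Φ.carrier A)}
  {NH : Subgroup (Field.absoluteGaloisGroup K) → tf.category → ℕ+ → Prop} {A₀ : tf.category}
  {hA₀ : PreFrobenioid.IsFrobeniusTrivial tf.toElem A₀} {hA₀' : SemiGraphs.IsGaloisObj A₀.base.obj}
  {lv : ℕ+} {θ : tf.biratUnitsModel A₀} {Bl : tf.category}
  {Pl : (BiKummerSetting.mkOfConnectedTemperoid X tf hZ hP NH A₀ hA₀ hA₀').FractionPair θ Bl}
  {Rl : (BiKummerSetting.mkOfConnectedTemperoid X tf hZ hP NH A₀ hA₀ hA₀').NthRoot θ Pl lv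
    (fun {_} φ x => tf.pullFracModel φ x)}
  (h : ModelFrobenioid.Hypotheses tf.divisorMonoid tf.ratFnFunctor)
  (R : ∀ N : ℕ+, (BiKummerSetting.mkOfConnectedTemperoid X tf hZ hP NH A₀ hA₀ hA₀').NthRoot Rl.root Rl.pair N
    (fun {_} φ x => tf.pullFracModel φ x))
  (φ : ∀ {N N' : ℕ+}, (N : ℕ) ∣ N' → ((R N').AN ⟶ (R N).AN))
  (hφ : ∀ {N N' : ℕ+} (hd : (N : ℕ) ∣ N'), PreFrobenioid.IsPullbackMorphism tf.toElem (φ hd))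
  (hb : ∀ {N N' : ℕ+} (hd : (N : ℕ) ∣ N'),
    ModelFrobenioid.baseMap (R N').αData.α₁ = ModelFrobenioid.baseMap (φ hd) ≫ ModelFrobenioid.baseMap (R N).αData.α₁)
  (hg : ∀ {N N' : ℕ+} (hd : (N : ℕ) ∣ N'), (R N').root ^ ((N' : ℕ) / N) = tf.pullFracModel (φ hd) (R N).root)
  (hsk : ∀ {N N' : ℕ+} (hd : (N : ℕ) ∣ N'), Nonempty ((R N').AN.base ≅ (R N).AN.base) → (R N').AN = (R N).AN)

include hφ hb hg hsk in
/-- **The Rmk. 4.3.2 transition INPUTS of `ofConnectedTemperoidFamily` together with `Base(α_{N,N′}) = Base(φ_{N,N′})`, PRODUCED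
from a covering family** — «by allowing `N` to vary, we obtain a compatible system of roots» (p. 319): given the root data `R N`
(`N ≥ 1`) of the `l`-th root's fraction-pair over `B^temp(Π^tp_X)⁰` and, for `N ∣ N′`, pull-back coverings `φ_{N,N′} : A_{N′} → A_N`
over which the pull-back parts compose, with compatible roots `f_{N′}^{N′/N} = φ^* f_N` and the skeleton clause, there are
`α_{N,N′}`, `β_{N,N′}` with the two commutative squares, isometries of Frobenius degree `N′/N` (`deg · N = N′`, in the
`sec5Stub` shapes of the tower's fields), `α_{N,N′}` of base-Frobenius type and `Base(α_{N,N′}) = Base(φ_{N,N′})`; `Φ` divisorial is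
`h.isDivisorial` ([FrdI] Thm. 5.2 hypotheses of the §5 data).  [cite: MochizukiEtTh2009, Rmk 4.3.2 p.318–319 (PDF pp.92–93); §5 p.330 (PDF p.104)] -/
theorem exists_transitions_with_given_ofConnectedTemperoid :
    ∃ (α : ∀ {N N' : ℕ+}, (N : ℕ) ∣ N' → ((R N').AN ⟶ (R N).AN))
      (β : ∀ {N N' : ℕ+}, (N : ℕ) ∣ N' → ((R N').BN ⟶ (R N).BN)),
      (∀ {N N' : ℕ+} (hd : (N : ℕ) ∣ N'), (R N').pair.num ≫ β hd = α hd ≫ (R N).pair.num) ∧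
        (∀ {N N' : ℕ+} (hd : (N : ℕ) ∣ N'), (R N').pair.den ≫ β hd = α hd ≫ (R N).pair.den) ∧
          (∀ {N N' : ℕ+} (hd : (N : ℕ) ∣ N'),
            ((BiKummerSetting.mkOfConnectedTemperoid X tf hZ hP NH A₀ hA₀ hA₀').sec5Stub h).pre.IsIsometry (α hd)) ∧
            (∀ {N N' : ℕ+} (hd : (N : ℕ) ∣ N'),
              (((BiKummerSetting.mkOfConnectedTemperoid X tf hZ hP NH A₀ hA₀ hA₀').sec5Stub h).pre.degFr (α hd) : ℕ) * N =
                N') ∧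
              (∀ {N N' : ℕ+} (hd : (N : ℕ) ∣ N'),
                ((BiKummerSetting.mkOfConnectedTemperoid X tf hZ hP NH A₀ hA₀ hA₀').sec5Stub h).pre.IsIsometry (β hd)) ∧
                (∀ {N N' : ℕ+} (hd : (N : ℕ) ∣ N'),
                  (((BiKummerSetting.mkOfConnectedTemperoid X tf hZ hP NH A₀ hA₀ hA₀').sec5Stub h).pre.degFr (β hd) : ℕ) *
                      N = N') ∧
                  (∀ {N N' : ℕ+} (hd : (N : ℕ) ∣ N'),
                    (BiKummerSetting.mkOfConnectedTemperoid X tf hZ hP NH A₀ hA₀ hA₀').IsOfBaseFrobeniusType (α hd)) ∧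
                    (∀ {N N' : ℕ+} (hd : (N : ℕ) ∣ N'),
                      ModelFrobenioid.baseMap (α hd) = ModelFrobenioid.baseMap (φ hd)) := by
  have key : ∀ (N N' : ℕ+) (hd : (N : ℕ) ∣ N'), ∃ (α : (R N').AN ⟶ (R N).AN) (β : (R N').BN ⟶ (R N).BN),
      (R N').pair.num ≫ β = α ≫ (R N).pair.num ∧ (R N').pair.den ≫ β = α ≫ (R N).pair.den ∧
        (BiKummerSetting.mkOfConnectedTemperoid X tf hZ hP NH A₀ hA₀ hA₀').IsIsometry α ∧
          ((BiKummerSetting.mkOfConnectedTemperoid X tf hZ hP NH A₀ hA₀ hA₀').degFr α : ℕ) * N = N' ∧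
            (BiKummerSetting.mkOfConnectedTemperoid X tf hZ hP NH A₀ hA₀ hA₀').IsIsometry β ∧
              ((BiKummerSetting.mkOfConnectedTemperoid X tf hZ hP NH A₀ hA₀ hA₀').degFr β : ℕ) * N = N' ∧
                (BiKummerSetting.mkOfConnectedTemperoid X tf hZ hP NH A₀ hA₀ hA₀').IsOfBaseFrobeniusType α ∧
                  ModelFrobenioid.baseMap α = ModelFrobenioid.baseMap (φ hd) :=
    fun N N' hd => BiKummerSetting.exists_rootTransition_of_nthRoots_of_dvd_mkOfConnectedTemperoid X tf hZ hP NH A₀ hA₀ hA₀'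
      h.isDivisorial (R N) (R N') hd (φ hd) (hφ hd) (hb hd) (hg hd) (hsk hd)
  choose α β hcn hcd hiα hdα hiβ hdβ hbf hbase using key
  exact ⟨fun {N N'} hd => α N N' hd, fun {N N'} hd => β N N' hd, fun hd => hcn _ _ hd, fun hd => hcd _ _ hd,
    fun hd => hiα _ _ hd, fun hd => hdα _ _ hd, fun hd => hiβ _ _ hd, fun hd => hdβ _ _ hd, fun hd => hbf _ _ hd,
    fun hd => hbase _ _ hd⟩

include hφ hb hg hsk in
/-- **The nine Rmk. 4.3.2 transition INPUTS of `ThetaFrobenioidTower.ofConnectedTemperoidFamily` PRODUCED from a covering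
family** (exactly its binders `α`, `β`, `comm_sCap`, `comm_sCup`, `isIsometry_α`, `degFr_α`, `isIsometry_β`, `degFr_β`,
`baseFrob_α` — the «inputs left» of `Discharge/Sec5TowerOfConnectedTemperoid.lean`), so that the §5 tower over the genuine
connected base is assembled from: the §4/§5 data, the root data `R N`, the constants, the divisor invariances, and a family of
pull-back coverings with compatible roots.  [cite: MochizukiEtTh2009, Rmk 4.3.2 p.318–319 (PDF pp.92–93); §5 p.330–331 (PDF pp.104–105)] -/
theorem exists_transitions_ofConnectedTemperoid :
    ∃ (α : ∀ {N N' : ℕ+}, (N : ℕ) ∣ N' → ((R N').AN ⟶ (R N).AN))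
      (β : ∀ {N N' : ℕ+}, (N : ℕ) ∣ N' → ((R N').BN ⟶ (R N).BN)),
      (∀ {N N' : ℕ+} (hd : (N : ℕ) ∣ N'), (R N').pair.num ≫ β hd = α hd ≫ (R N).pair.num) ∧
        (∀ {N N' : ℕ+} (hd : (N : ℕ) ∣ N'), (R N').pair.den ≫ β hd = α hd ≫ (R N).pair.den) ∧
          (∀ {N N' : ℕ+} (hd : (N : ℕ) ∣ N'),
            ((BiKummerSetting.mkOfConnectedTemperoid X tf hZ hP NH A₀ hA₀ hA₀').sec5Stub h).pre.IsIsometry (α hd)) ∧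
            (∀ {N N' : ℕ+} (hd : (N : ℕ) ∣ N'),
              (((BiKummerSetting.mkOfConnectedTemperoid X tf hZ hP NH A₀ hA₀ hA₀').sec5Stub h).pre.degFr (α hd) : ℕ) * N =
                N') ∧
              (∀ {N N' : ℕ+} (hd : (N : ℕ) ∣ N'),
                ((BiKummerSetting.mkOfConnectedTemperoid X tf hZ hP NH A₀ hA₀ hA₀').sec5Stub h).pre.IsIsometry (β hd)) ∧
                (∀ {N N' : ℕ+} (hd : (N : ℕ) ∣ N'),
                  (((BiKummerSetting.mkOfConnectedTemperoid X tf hZ hP NH A₀ hA₀ hA₀').sec5Stub h).pre.degFr (β hd) : ℕ) *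
                      N = N') ∧
                  (∀ {N N' : ℕ+} (hd : (N : ℕ) ∣ N'),
                    (BiKummerSetting.mkOfConnectedTemperoid X tf hZ hP NH A₀ hA₀ hA₀').IsOfBaseFrobeniusType (α hd)) := by
  obtain ⟨α, β, hcn, hcd, hiα, hdα, hiβ, hdβ, hbf, -⟩ :=
    exists_transitions_with_given_ofConnectedTemperoid h R φ hφ hb hg hsk
  exact ⟨α, β, hcn, hcd, hiα, hdα, hiβ, hdβ, hbf⟩

include hφ hb hg hsk in
/-- **The §5 tower over the genuine connected base, ASSEMBLED FROM A COVERING FAMILY** — no Rmk. 4.3.2 transition input left: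
for a §2 tower `𝒯`, constants and the divisor invariances at every level, there is a `ThetaFrobenioidTower` over
`mkOfConnectedTemperoid` (abc-iut-L2-t4's `ofConnectedTemperoidFamily` fed with the transitions of
`exists_transitions_ofConnectedTemperoid`) whose level `M ∈ E` IS the §5 data `ThetaFrobenioid.ofConnectedTemperoidData` over
`𝒯.level M` and whose section property `StrvSection` holds at every level `N ≥ 1` (`atLevel_ofConnectedTemperoidFamily_eq`,
`strvSection_atLevel_ofConnectedTemperoidFamily`, consumed by name).
[cite: MochizukiEtTh2009, Rmk 4.3.2 p.319 (PDF p.93); §5 p.330–331 (PDF pp.104–105)] -/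
theorem exists_tower_atLevel_eq_ofConnectedTemperoidData {E : Set ℕ+} {𝒯 : ThetaEnvTower.{max u₀ w} E}
    (Q : FrobenioidTheta.ThetaSubquotientStub.{w} (ConnectedPart (BTemp X.Pi))) (odd_l : Odd (lv : ℕ))
    (ιX : 𝒯.PiX ≃ₜ* X.Pi) (K' : Type w) [Field K'] (constEmb : ∀ N : ℕ+, K'ˣ →* tf.biratUnitsModel (R N).BN)
    (constEmb_injective : ∀ N : ℕ+, Function.Injective (constEmb N))
    (hinvc : ∀ (N : ℕ+) (g : Aut (R N).AN.base),
      pull tf.divisorMonoid g.hom (ModelFrobenioid.div (R N).pair.num) = ModelFrobenioid.div (R N).pair.num)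
    (hinvp : ∀ (N : ℕ+) (y : 𝒯.PiX), y ∈ 𝒯.PiYdd →
      pull tf.divisorMonoid ((BiKummerSetting.mkOfConnectedTemperoid X tf hZ hP NH A₀ hA₀ hA₀').galoisSurj (R N).AN.base
        (R N).αData.isGalois (ιX y)).hom (ModelFrobenioid.div (R N).pair.den) = ModelFrobenioid.div (R N).pair.den) :
    ∃ 𝔗 : ThetaFrobenioidTower.{w} (BiKummerSetting.mkOfConnectedTemperoid X tf hZ hP NH A₀ hA₀ hA₀').C
        (ConnectedPart (BTemp X.Pi)),
      (∀ M : E, 𝔗.atLevel M =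
          ThetaFrobenioid.ofConnectedTemperoidData (pullFrac := fun {_ _} φ x => tf.pullFracModel φ x) (T := 𝒯.level M) h Q
            odd_l (R M) ιX K' (constEmb M) (constEmb_injective M) (hinvc M) (hinvp M)) ∧
        ∀ N : ℕ+, (𝔗.atLevel N).StrvSection := by
  obtain ⟨α, β, hcn, hcd, hiα, hdα, hiβ, hdβ, hbf⟩ := exists_transitions_ofConnectedTemperoid h R φ hφ hb hg hsk
  exact ⟨ofConnectedTemperoidFamily (pullFrac := fun {_ _} φ x => tf.pullFracModel φ x) h Q odd_l R ιX K' constEmb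
      constEmb_injective hinvc hinvp α β hcn hcd hiα hdα hiβ hdβ hbf,
    fun M => atLevel_ofConnectedTemperoidFamily_eq (pullFrac := fun {_ _} φ x => tf.pullFracModel φ x) h Q odd_l R ιX K'
      constEmb constEmb_injective hinvc hinvp α β hcn hcd hiα hdα hiβ hdβ hbf M,
    fun N => strvSection_atLevel_ofConnectedTemperoidFamily (pullFrac := fun {_ _} φ x => tf.pullFracModel φ x) h Q odd_l R
      ιX K' constEmb constEmb_injective hinvc hinvp α β hcn hcd hiα hdα hiβ hdβ hbf N⟩

end ThetaFrobenioidTower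

end Literature.AnabelianGeometry.EtaleTheta

end

-- tree-health (abc-iut-w6-d081 g4, 2026-08-26T12:44Z): comment-only re-land of a STRANDED ACCEPT (module accepted, not importable on the farm for > 60 min);
-- declarations byte-identical to the accepted version; purpose = trigger the rebuild (w4-d014 10:34:09Z remedy class). No content change.
-- tree-health (abc-iut-w6-d081 g4, 2026-08-26T14:24Z): second comment-only re-land — the 12:44Z re-land batch did not regain a farm olean in 95 min while the 12:55Z and 13:5xZ batches did within ≈20 min (suspected dispatch gap at 12:44Z); declarations byte-identical.
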